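import Summits.QuantumFields.YangMills.Theorems.UnitScaleTiltProp7IterLambdaBound
import Summits.QuantumFields.YangMills.Theorems.UnitScaleTiltProp7TentInterpolation
import HarnessLib

/-!
# N8 (file 2 of 3) — THE POINT-PINNED BLOCK POINCARÉ INEQUALITY (d = 3):
# `v(embIter k y) = 0 ∀y ⇒ Σ_x v(x)² ≤ C_pin(L)·(L^k)³·Σ_b (∂v)(b)²`, `C_pin(L) = (1 + L³/(√L − 1)²)/4`
(route R of crux K1 «MinimiserStabilityRegPr», stmt-QuantumFields-19200; W-SEAT MAP #3 row M8 «N8 = N7-inhomogeneous»; cell `ym3-torus`, width seat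
`ym-ust-19200-w1` g5 = routeR-w1; `--supports stmt-QuantumFields-19200 --as helper`, count-neutral)

YM₃ on T³ is a RUNG of the ladder (R3), not the Clay problem; nothing here claims the stub, the crux or the gap.

WHY.  File 3's Dirichlet corrector `∂u` (`u = 0` at the `k`-centres) has `Σ(∂u)² ≤ ‖u‖·‖Δu‖_{off}` and `‖u‖² ≤ C_pin·(L^k)³·Σ(∂u)²` is this file;
`(L^k)³` = the capacity of a point in a cube of side `L^k` (d = 3), sharp on the lattice Green's function with pole at the centre.
WHAT IS PROVED (sorry-free, no definition; real site functions on the finest torus `Site P 0`; `B^e(z) = {x : Site.proj e e x = z}`; the block mean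
`m_e(z) = (L^e)^{−d}·Σ_{B^e(z)} v`; the interior energy `E_e(v)(z) = Σ_ν Σ_{x ∈ B^e(z)} [x + e_ν ∈ B^e(z)]·(v(x + e_ν) − v(x))²`):
* §1 `card_block` (`|B^e(z)| = (L^e)^d`), `proj_embIter` (`embIter k y ∈ B^k(y)`), `block_zero_sum` (`B^0(x) = {x}` for sums), `energy_mono_blockOf`.
* §2 `sum_sq_sub_mean_le` — cube Poincaré with mean for site functions: `Σ_{B^e(z)} (v − m_e(z))² ≤ ((L^e)²/8)·E_e(v)(z)` (`B4Block227.poincare_coordCube8` along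
  `bsite`).
* §3 `mean_sub_mean_sq_le` (d = 3) — nested means: `(m_j(z) − m_{j+1}(blockOf z))² ≤ (L²/8)·L^{−j}·E_{j+1}(v)(blockOf z)` (Cauchy–Schwarz on `B^j(z)`, nesting, §2).
* §4 `sq_sub_mean_le_energy` (d = 3) — telescoping from `B^0(c) = {c}` to `B^k`: `(v(c) − m_k(proj_k c))² ≤ (L³/(8(√L−1)²))·E_k(v)(proj_k c)` (geometric Σ_j L^{−j/2}).
* §5 ★ `sum_sq_block_le_of_eq_zero_centre` — `v(embIter k y) = 0 ⇒ Σ_{B^k(y)} v² ≤ C_pin(L)·(L^k)³·E_k(v)(y)`;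
  ★★ `sum_sq_le_grad_sq_of_eq_zero_centres` — `(∀ y, v(embIter k y) = 0) ⇒ Σ_x v(x)² ≤ C_pin(L)·(L^k)³·Σ_b (grad 1 v b)²`.
-/

set_option autoImplicit false

noncomputable section

open scoped BigOperators

namespace Summit.QuantumFields.YangMills.Theorems.Prop7PointPinnedPoincare

open Literature.MathematicalPhysics.QuantumFieldTheory.Balaban1983to89
open Finset T4Continuum LatticeFieldCalculus B1RG242Torus
open B15DeterminingSets (embIter)
open B10StarCount (sum_pbond)
open B5Leaf237C0Torus (bsite bsite_stepUp proj_bsite)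
open Beta.CoordCubePoincare (stepUp)
open Beta.BlockPoincare (avg)
open B4Block227 (poincare_coordCube8)
open Summit.QuantumFields.YangMills.Theorems.Prop7FlatCoercivity (sum_fibre_eq_sum_offsets sum_fibre_succ sitesPerDir_zero_eq_pow_mul sum_shift)
open Summit.QuantumFields.YangMills.Theorems.Prop7IterLambdaBound (sum_offsets_eq_sum_filter sum_interior_le_sum_filter sum_filter_le_sum_filter_succ
  proj_succ_of_proj sitesPerDir_succ_of_le sqrt_pow_eq)
open Summit.QuantumFields.YangMills.Theorems.Prop7TentInterpolation (val_embIter)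

variable {P : Params}

/-! ## §1 Blocks: cardinality, the centre, the one-point block, nesting of interior energies -/

/-- `|B^e(z)| = (L^e)^d`, real form. [folklore] -/
theorem card_block {e : ℕ} (h : P.sitesPerDir 0 = P.L ^ e * P.sitesPerDir e) (z : Site P e) :
    ((univ.filter (fun x : Site P 0 => Site.proj e e x = z)).card : ℝ) = ((P.L : ℝ) ^ e) ^ P.d := by
  have hs := sum_fibre_eq_sum_offsets h z (fun _ : Site P 0 => (1 : ℝ))
  rw [Finset.sum_const, Finset.sum_const, Finset.card_univ, Fintype.card_pi, Finset.prod_const, Finset.card_univ,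
    Fintype.card_fin, Fintype.card_fin, nsmul_eq_mul, nsmul_eq_mul, mul_one, mul_one] at hs
  rw [hs]
  push_cast
  ring

/-- **THE CENTRE LIES IN ITS BLOCK**: `Site.proj k k (embIter k y) = y`. [cite: Balaban1987RG1, (0.1) p.251] -/
theorem proj_embIter {k : ℕ} (hk : k ≤ P.m + P.K) (y : Site P k) : Site.proj k k (embIter k y) = y := by
  have h := sitesPerDir_zero_eq_pow_mul (P := P) hk
  funext μ
  apply ZMod.val_injective
  rw [Site.val_proj h, val_embIter hk y μ]
  have hL : 0 < P.L ^ k := pow_pos P.L_pos k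
  rw [Nat.add_div hL, Nat.mul_div_cancel _ hL, Nat.div_eq_of_lt (by omega : (P.L ^ k - 1) / 2 < P.L ^ k)]
  rw [Nat.mul_mod_left, zero_add, if_neg (by rw [not_le]; exact Nat.mod_lt _ hL)]
  rfl

/-- The level-0 block of `c` is `{c}`: `Σ_{x : proj 0 0 x = c} G(x) = G(c)`. [folklore] -/
theorem block_zero_sum {M : Type*} [AddCommMonoid M] (c : Site P 0) (G : Site P 0 → M) :
    ∑ x ∈ univ.filter (fun x : Site P 0 => Site.proj 0 0 x = c), G x = G c := by
  have hset : univ.filter (fun x : Site P 0 => Site.proj 0 0 x = c) = {c} := by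
    ext x
    simp only [Finset.mem_filter, Finset.mem_univ, true_and, Finset.mem_singleton, Site.proj_zero]
  rw [hset, Finset.sum_singleton]

/-- **NESTING OF THE INTERIOR ENERGIES**: `E_j(v)(z) ≤ E_{j+1}(v)(blockOf z)` (interior bond pairs of `B^j(z)` are interior bond pairs of `B^{j+1}(blockOf z)`).
[folklore] -/
theorem energy_mono_blockOf {j : ℕ} (hj : j + 1 ≤ P.m + P.K) (z : Site P j) (v : Site P 0 → ℝ) :
    (∑ ν : Fin P.d, ∑ x ∈ univ.filter (fun x : Site P 0 => Site.proj j j x = z),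
        (if Site.proj j j (x.shift ν) = z then (v (x.shift ν) - v x) ^ 2 else 0))
      ≤ ∑ ν : Fin P.d, ∑ x ∈ univ.filter (fun x : Site P 0 => Site.proj (j + 1) (j + 1) x = blockOf z),
        (if Site.proj (j + 1) (j + 1) (x.shift ν) = blockOf z then (v (x.shift ν) - v x) ^ 2 else 0) := by
  have h0j : P.sitesPerDir 0 = P.L ^ j * P.sitesPerDir j := sitesPerDir_zero_eq_pow_mul (Nat.le_of_succ_le hj)
  have h' : P.sitesPerDir j = P.L ^ 1 * P.sitesPerDir (j + 1) := sitesPerDir_succ_of_le hj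
  have hup : ∀ x : Site P 0, Site.proj j j x = z → Site.proj (j + 1) (j + 1) x = blockOf z := fun x hx =>
    proj_succ_of_proj h0j h' hx
  refine Finset.sum_le_sum fun ν _ => ?_
  rw [Finset.sum_filter, Finset.sum_filter]
  refine Finset.sum_le_sum fun x _ => ?_
  by_cases hx : Site.proj j j x = z
  · rw [if_pos hx, if_pos (hup x hx)]
    by_cases hx' : Site.proj j j (x.shift ν) = z
    · rw [if_pos hx', if_pos (hup _ hx')]
    · rw [if_neg hx']
      split_ifs <;> positivity
  · rw [if_neg hx]
    split_ifs <;> positivity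

/-! ## §2 Cube Poincaré with mean for real site functions -/

/-- **CUBE POINCARÉ WITH MEAN** on the block `B^e(z)` (side `L^e`): `Σ_{B^e(z)} (v − m_e(z))² ≤ ((L^e)²/8)·E_e(v)(z)`, `m_e(z)` the block mean
(`B4Block227.poincare_coordCube8` in the offset chart `bsite`). [cite: Balaban1983RegularityDecay, (2.27) p.580] -/
theorem sum_sq_sub_mean_le {e : ℕ} (he : e ≤ P.m + P.K) (z : Site P e) (v : Site P 0 → ℝ) :
    ∑ x ∈ univ.filter (fun x : Site P 0 => Site.proj e e x = z),
        (v x - (((P.L : ℝ) ^ e) ^ P.d)⁻¹ * ∑ x' ∈ univ.filter (fun x : Site P 0 => Site.proj e e x = z), v x') ^ 2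
      ≤ ((P.L : ℝ) ^ e) ^ 2 / 8 * ∑ ν : Fin P.d, ∑ x ∈ univ.filter (fun x : Site P 0 => Site.proj e e x = z),
          (if Site.proj e e (x.shift ν) = z then (v (x.shift ν) - v x) ^ 2 else 0) := by
  classical
  have h := sitesPerDir_zero_eq_pow_mul (P := P) he
  obtain ⟨n, hn⟩ : ∃ n, n + 1 = P.L ^ e := ⟨P.L ^ e - 1, Nat.sub_add_cancel (Nat.one_le_pow _ _ P.L_pos)⟩
  have hLe : ((P.L : ℝ) ^ e) = (n : ℝ) + 1 := by exact_mod_cast hn.symm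
  set g : (Fin P.d → Fin (n + 1)) → ℝ := fun r => v (bsite P 0 e hn z r) with hg
  have hP := poincare_coordCube8 n P.d g
  -- the mean
  have havg : avg univ g = (((P.L : ℝ) ^ e) ^ P.d)⁻¹ * ∑ x' ∈ univ.filter (fun x : Site P 0 => Site.proj e e x = z), v x' := by
    unfold avg
    rw [Finset.card_univ, Fintype.card_pi, Finset.prod_const, Finset.card_univ, Fintype.card_fin, Fintype.card_fin, hg,
      sum_offsets_eq_sum_filter h hn z v, hLe, div_eq_inv_mul]
    push_cast
    rfl
  -- the left-hand side
  have hL : ∑ r : Fin P.d → Fin (n + 1), (g r - avg univ g) ^ 2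
      = ∑ x ∈ univ.filter (fun x : Site P 0 => Site.proj e e x = z),
          (v x - (((P.L : ℝ) ^ e) ^ P.d)⁻¹ * ∑ x' ∈ univ.filter (fun x : Site P 0 => Site.proj e e x = z), v x') ^ 2 := by
    rw [havg, hg]
    exact sum_offsets_eq_sum_filter h hn z (fun x => (v x - (((P.L : ℝ) ^ e) ^ P.d)⁻¹ *
      ∑ x' ∈ univ.filter (fun x : Site P 0 => Site.proj e e x = z), v x') ^ 2)
  -- the right-hand side: interior offset pairs are interior bond pairs
  have hR : ∑ μ : Fin P.d, ∑ r ∈ univ.filter (fun r : Fin P.d → Fin (n + 1) => r μ ≠ Fin.last n), (g (stepUp r μ) - g r) ^ 2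
      ≤ ∑ ν : Fin P.d, ∑ x ∈ univ.filter (fun x : Site P 0 => Site.proj e e x = z),
          (if Site.proj e e (x.shift ν) = z then (v (x.shift ν) - v x) ^ 2 else 0) := by
    have h1 : ∀ μ : Fin P.d, ∑ r ∈ univ.filter (fun r : Fin P.d → Fin (n + 1) => r μ ≠ Fin.last n), (g (stepUp r μ) - g r) ^ 2
        = ∑ r ∈ univ.filter (fun r : Fin P.d → Fin (n + 1) => r μ ≠ Fin.last n),
            (fun x' x : Site P 0 => (v x' - v x) ^ 2) ((bsite P 0 e hn z r).shift μ) (bsite P 0 e hn z r) := by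
      intro μ
      refine Finset.sum_congr rfl fun r hr => ?_
      have hr' : r μ ≠ Fin.last n := (Finset.mem_filter.mp hr).2
      simp only [hg, bsite_stepUp P hn z r μ hr']
    simp only [h1]
    exact sum_interior_le_sum_filter h hn z (fun x' x : Site P 0 => (v x' - v x) ^ 2) fun _ _ => sq_nonneg _
  rw [← hL, hLe]
  exact hP.trans (mul_le_mul_of_nonneg_left hR (by positivity))

/-! ## §3 Nested means (d = 3) -/

/-- **MEAN OF A BLOCK VS MEAN OF ITS PARENT** (`d = 3`): `(m_j(z) − m_{j+1}(blockOf z))² ≤ (L²/8)·(L^j)⁻¹·E_{j+1}(v)(blockOf z)` —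
Cauchy–Schwarz on `B^j(z)` (`|B^j| = L^{3j}`), nesting `B^j(z) ⊂ B^{j+1}(blockOf z)`, and §2 on the parent (`L^{2(j+1)}/(8L^{3j}) = L²/(8L^j)`). [folklore] -/
theorem mean_sub_mean_sq_le (hd : P.d = 3) {j : ℕ} (hj : j + 1 ≤ P.m + P.K) (z : Site P j) (v : Site P 0 → ℝ) :
    ((((P.L : ℝ) ^ j) ^ P.d)⁻¹ * ∑ x ∈ univ.filter (fun x : Site P 0 => Site.proj j j x = z), v x
        - (((P.L : ℝ) ^ (j + 1)) ^ P.d)⁻¹ * ∑ x ∈ univ.filter (fun x : Site P 0 => Site.proj (j + 1) (j + 1) x = blockOf z), v x) ^ 2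
      ≤ (P.L : ℝ) ^ 2 / 8 * ((P.L : ℝ) ^ j)⁻¹ *
          ∑ ν : Fin P.d, ∑ x ∈ univ.filter (fun x : Site P 0 => Site.proj (j + 1) (j + 1) x = blockOf z),
            (if Site.proj (j + 1) (j + 1) (x.shift ν) = blockOf z then (v (x.shift ν) - v x) ^ 2 else 0) := by
  classical
  have hj' : j ≤ P.m + P.K := Nat.le_of_succ_le hj
  have h0j : P.sitesPerDir 0 = P.L ^ j * P.sitesPerDir j := sitesPerDir_zero_eq_pow_mul hj'
  have h' : P.sitesPerDir j = P.L ^ 1 * P.sitesPerDir (j + 1) := sitesPerDir_succ_of_le hj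
  have hL0 : (0 : ℝ) < P.L := by exact_mod_cast P.L_pos
  set S := univ.filter (fun x : Site P 0 => Site.proj j j x = z) with hS
  set S' := univ.filter (fun x : Site P 0 => Site.proj (j + 1) (j + 1) x = blockOf z) with hS'
  set M : ℝ := (((P.L : ℝ) ^ (j + 1)) ^ P.d)⁻¹ * ∑ x ∈ S', v x with hM
  set E : ℝ := ∑ ν : Fin P.d, ∑ x ∈ S', (if Site.proj (j + 1) (j + 1) (x.shift ν) = blockOf z then (v (x.shift ν) - v x) ^ 2 else 0) with hE
  have hcard : (S.card : ℝ) = ((P.L : ℝ) ^ j) ^ P.d := card_block h0j z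
  have hcpos : (0 : ℝ) < ((P.L : ℝ) ^ j) ^ P.d := by positivity
  -- the mean difference as a block mean of `v − M`
  have hdiff : (((P.L : ℝ) ^ j) ^ P.d)⁻¹ * ∑ x ∈ S, v x - M = (((P.L : ℝ) ^ j) ^ P.d)⁻¹ * ∑ x ∈ S, (v x - M) := by
    rw [Finset.sum_sub_distrib, Finset.sum_const, nsmul_eq_mul, hcard, mul_sub, ← mul_assoc, inv_mul_cancel₀ hcpos.ne', one_mul]
  rw [hdiff]
  -- Cauchy–Schwarz on `S`
  have hCS : ((((P.L : ℝ) ^ j) ^ P.d)⁻¹ * ∑ x ∈ S, (v x - M)) ^ 2 ≤ (((P.L : ℝ) ^ j) ^ P.d)⁻¹ * ∑ x ∈ S, (v x - M) ^ 2 := by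
    have h1 := sq_sum_le_card_mul_sum_sq (s := S) (f := fun x => v x - M)
    rw [hcard] at h1
    rw [mul_pow]
    calc ((((P.L : ℝ) ^ j) ^ P.d)⁻¹) ^ 2 * (∑ x ∈ S, (v x - M)) ^ 2
        ≤ ((((P.L : ℝ) ^ j) ^ P.d)⁻¹) ^ 2 * (((P.L : ℝ) ^ j) ^ P.d * ∑ x ∈ S, (v x - M) ^ 2) :=
          mul_le_mul_of_nonneg_left h1 (by positivity)
      _ = (((P.L : ℝ) ^ j) ^ P.d)⁻¹ * ∑ x ∈ S, (v x - M) ^ 2 := by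
          field_simp
  -- nesting and §2 on the parent
  have hnest : ∑ x ∈ S, (v x - M) ^ 2 ≤ ∑ x ∈ S', (v x - M) ^ 2 :=
    sum_filter_le_sum_filter_succ h0j h' (blockOf z) rfl (fun x => (v x - M) ^ 2) fun _ => sq_nonneg _
  have hpar : ∑ x ∈ S', (v x - M) ^ 2 ≤ ((P.L : ℝ) ^ (j + 1)) ^ 2 / 8 * E := sum_sq_sub_mean_le hj (blockOf z) v
  have hd3 : ((P.L : ℝ) ^ j) ^ P.d = (P.L : ℝ) ^ j * ((P.L : ℝ) ^ j) ^ 2 := by rw [hd]; ring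
  have hE0 : 0 ≤ E := Finset.sum_nonneg fun _ _ => Finset.sum_nonneg fun _ _ => by split_ifs <;> positivity
  calc ((((P.L : ℝ) ^ j) ^ P.d)⁻¹ * ∑ x ∈ S, (v x - M)) ^ 2
      ≤ (((P.L : ℝ) ^ j) ^ P.d)⁻¹ * ∑ x ∈ S, (v x - M) ^ 2 := hCS
    _ ≤ (((P.L : ℝ) ^ j) ^ P.d)⁻¹ * (((P.L : ℝ) ^ (j + 1)) ^ 2 / 8 * E) :=
        mul_le_mul_of_nonneg_left (hnest.trans hpar) (by positivity)
    _ = (P.L : ℝ) ^ 2 / 8 * ((P.L : ℝ) ^ j)⁻¹ * E := by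
        rw [hd3, pow_succ]
        field_simp
        ring

/-! ## §4 Telescoping from the point to the block (d = 3) -/

/-- **THE POINT VALUE VS THE BLOCK MEAN** (`d = 3`): for every fine site `c` and `k ≤ m + K`,
`|v(c) − m_k(proj_k c)| ≤ (L/√8)·(Σ_{j<k} (1/√L)^j)·√(E_k(v)(proj_k c))` — telescoping over the nested blocks `B^0(c) = {c} ⊂ B^1 ⊂ … ⊂ B^k`,
each step by §3 and the nesting of energies. [folklore] -/
theorem abs_sub_mean_le_geom (hd : P.d = 3) : ∀ (k : ℕ), k ≤ P.m + P.K → ∀ (c : Site P 0) (v : Site P 0 → ℝ),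
    |v c - (((P.L : ℝ) ^ k) ^ P.d)⁻¹ * ∑ x ∈ univ.filter (fun x : Site P 0 => Site.proj k k x = Site.proj k k c), v x|
      ≤ Real.sqrt ((P.L : ℝ) ^ 2 / 8) * (∑ j ∈ Finset.range k, (Real.sqrt P.L)⁻¹ ^ j) *
          Real.sqrt (∑ ν : Fin P.d, ∑ x ∈ univ.filter (fun x : Site P 0 => Site.proj k k x = Site.proj k k c),
            (if Site.proj k k (x.shift ν) = Site.proj k k c then (v (x.shift ν) - v x) ^ 2 else 0))
  | 0, _, c, v => by
    rw [Site.proj_zero, block_zero_sum c v, pow_zero, one_pow, inv_one, one_mul, sub_self, abs_zero, Finset.range_zero,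
      Finset.sum_empty, mul_zero, zero_mul]
  | k + 1, hk, c, v => by
    classical
    have hk' : k ≤ P.m + P.K := Nat.le_of_succ_le hk
    have hL0 : (0 : ℝ) < P.L := by exact_mod_cast P.L_pos
    have ih := abs_sub_mean_le_geom hd k hk' c v
    have hb : Site.proj (k + 1) (k + 1) c = blockOf (Site.proj k k c) :=
      proj_succ_of_proj (sitesPerDir_zero_eq_pow_mul hk') (sitesPerDir_succ_of_le hk) rfl
    -- letters
    set mk : ℝ := (((P.L : ℝ) ^ k) ^ P.d)⁻¹ * ∑ x ∈ univ.filter (fun x : Site P 0 => Site.proj k k x = Site.proj k k c), v x with hmk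
    set Ek : ℝ := ∑ ν : Fin P.d, ∑ x ∈ univ.filter (fun x : Site P 0 => Site.proj k k x = Site.proj k k c),
      (if Site.proj k k (x.shift ν) = Site.proj k k c then (v (x.shift ν) - v x) ^ 2 else 0) with hEk
    set mk1 : ℝ := (((P.L : ℝ) ^ (k + 1)) ^ P.d)⁻¹ *
      ∑ x ∈ univ.filter (fun x : Site P 0 => Site.proj (k + 1) (k + 1) x = Site.proj (k + 1) (k + 1) c), v x with hmk1
    set Ek1 : ℝ := ∑ ν : Fin P.d, ∑ x ∈ univ.filter (fun x : Site P 0 => Site.proj (k + 1) (k + 1) x = Site.proj (k + 1) (k + 1) c),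
      (if Site.proj (k + 1) (k + 1) (x.shift ν) = Site.proj (k + 1) (k + 1) c then (v (x.shift ν) - v x) ^ 2 else 0) with hEk1
    -- energies nest
    have hmono : Ek ≤ Ek1 := by
      have := energy_mono_blockOf hk (Site.proj k k c) v
      rw [← hb] at this
      simpa only [hEk, hEk1] using this
    -- one step of §3
    have hstep : (mk - mk1) ^ 2 ≤ (P.L : ℝ) ^ 2 / 8 * ((P.L : ℝ) ^ k)⁻¹ * Ek1 := by
      have := mean_sub_mean_sq_le hd hk (Site.proj k k c) v
      rw [← hb] at this
      simpa only [hmk, hmk1, hEk1] using this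
    have hstep' : |mk - mk1| ≤ Real.sqrt ((P.L : ℝ) ^ 2 / 8) * (Real.sqrt P.L)⁻¹ ^ k * Real.sqrt Ek1 := by
      rw [← Real.sqrt_sq_eq_abs]
      calc Real.sqrt ((mk - mk1) ^ 2) ≤ Real.sqrt ((P.L : ℝ) ^ 2 / 8 * ((P.L : ℝ) ^ k)⁻¹ * Ek1) := Real.sqrt_le_sqrt hstep
        _ = Real.sqrt ((P.L : ℝ) ^ 2 / 8) * (Real.sqrt P.L)⁻¹ ^ k * Real.sqrt Ek1 := by
            rw [Real.sqrt_mul (by positivity), Real.sqrt_mul (by positivity), Real.sqrt_inv, sqrt_pow_eq _ hL0.le, inv_pow]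
    -- assemble: `|v c − m_{k+1}| ≤ |v c − m_k| + |m_k − m_{k+1}|`
    have hA0 : 0 ≤ Real.sqrt ((P.L : ℝ) ^ 2 / 8) := Real.sqrt_nonneg _
    have hS0 : 0 ≤ ∑ j ∈ Finset.range k, (Real.sqrt P.L)⁻¹ ^ j := Finset.sum_nonneg fun _ _ => by positivity
    have hsq : Real.sqrt Ek ≤ Real.sqrt Ek1 := Real.sqrt_le_sqrt hmono
    have htri : |v c - mk1| ≤ |v c - mk| + |mk - mk1| := abs_sub_le (v c) mk mk1
    have ih' : |v c - mk| ≤ Real.sqrt ((P.L : ℝ) ^ 2 / 8) * (∑ j ∈ Finset.range k, (Real.sqrt P.L)⁻¹ ^ j) * Real.sqrt Ek1 :=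
      ih.trans (mul_le_mul_of_nonneg_left hsq (mul_nonneg hA0 hS0))
    rw [Finset.sum_range_succ]
    calc |v c - mk1| ≤ |v c - mk| + |mk - mk1| := htri
      _ ≤ Real.sqrt ((P.L : ℝ) ^ 2 / 8) * (∑ j ∈ Finset.range k, (Real.sqrt P.L)⁻¹ ^ j) * Real.sqrt Ek1
          + Real.sqrt ((P.L : ℝ) ^ 2 / 8) * (Real.sqrt P.L)⁻¹ ^ k * Real.sqrt Ek1 := add_le_add ih' hstep'
      _ = Real.sqrt ((P.L : ℝ) ^ 2 / 8) * (∑ j ∈ Finset.range k, (Real.sqrt P.L)⁻¹ ^ j + (Real.sqrt P.L)⁻¹ ^ k) * Real.sqrt Ek1 := by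
          ring

/-- **SQUARED FORM WITH THE GEOMETRIC SUM EVALUATED** (`d = 3`): `(v(c) − m_k(proj_k c))² ≤ (L³/(8(√L − 1)²))·E_k(v)(proj_k c)` —
`Σ_{j<k} (1/√L)^j ≤ √L/(√L − 1)`, no `k`, no `log L^k`. [folklore] -/
theorem sq_sub_mean_le_energy (hd : P.d = 3) {k : ℕ} (hk : k ≤ P.m + P.K) (c : Site P 0) (v : Site P 0 → ℝ) :
    (v c - (((P.L : ℝ) ^ k) ^ P.d)⁻¹ * ∑ x ∈ univ.filter (fun x : Site P 0 => Site.proj k k x = Site.proj k k c), v x) ^ 2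
      ≤ (P.L : ℝ) ^ 3 / (8 * (Real.sqrt P.L - 1) ^ 2) *
          ∑ ν : Fin P.d, ∑ x ∈ univ.filter (fun x : Site P 0 => Site.proj k k x = Site.proj k k c),
            (if Site.proj k k (x.shift ν) = Site.proj k k c then (v (x.shift ν) - v x) ^ 2 else 0) := by
  have h := abs_sub_mean_le_geom hd k hk c v
  have hL1 : (1 : ℝ) < P.L := by exact_mod_cast P.hL.2
  have hL0 : (0 : ℝ) < P.L := by positivity
  have hs1 : 1 < Real.sqrt P.L := by
    rw [show (1 : ℝ) = Real.sqrt 1 from Real.sqrt_one.symm]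
    exact Real.sqrt_lt_sqrt zero_le_one hL1
  have hr0 : 0 ≤ (Real.sqrt P.L)⁻¹ := by positivity
  have hr1 : (Real.sqrt P.L)⁻¹ < 1 := inv_lt_one_of_one_lt₀ hs1
  -- the geometric sum
  have hgeom : ∑ j ∈ Finset.range k, (Real.sqrt P.L)⁻¹ ^ j ≤ Real.sqrt P.L / (Real.sqrt P.L - 1) := by
    have hg := geom_sum_Ico_le_of_lt_one hr0 hr1 (m := 0) (n := k)
    rw [← Finset.range_eq_Ico, pow_zero] at hg
    refine hg.trans (le_of_eq ?_)
    have hne : Real.sqrt P.L - 1 ≠ 0 := (sub_pos.mpr hs1).ne'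
    field_simp
  set E : ℝ := ∑ ν : Fin P.d, ∑ x ∈ univ.filter (fun x : Site P 0 => Site.proj k k x = Site.proj k k c),
    (if Site.proj k k (x.shift ν) = Site.proj k k c then (v (x.shift ν) - v x) ^ 2 else 0) with hE
  have hE0 : 0 ≤ E := Finset.sum_nonneg fun _ _ => Finset.sum_nonneg fun _ _ => by split_ifs <;> positivity
  set D : ℝ := v c - (((P.L : ℝ) ^ k) ^ P.d)⁻¹ * ∑ x ∈ univ.filter (fun x : Site P 0 => Site.proj k k x = Site.proj k k c), v x with hD
  have hA0 : 0 ≤ Real.sqrt ((P.L : ℝ) ^ 2 / 8) := Real.sqrt_nonneg _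
  have hS0 : 0 ≤ ∑ j ∈ Finset.range k, (Real.sqrt P.L)⁻¹ ^ j := Finset.sum_nonneg fun _ _ => by positivity
  have h' : |D| ≤ Real.sqrt ((P.L : ℝ) ^ 2 / 8) * (Real.sqrt P.L / (Real.sqrt P.L - 1)) * Real.sqrt E :=
    h.trans (mul_le_mul_of_nonneg_right (mul_le_mul_of_nonneg_left hgeom hA0) (Real.sqrt_nonneg _))
  have hsq : D ^ 2 ≤ (Real.sqrt ((P.L : ℝ) ^ 2 / 8) * (Real.sqrt P.L / (Real.sqrt P.L - 1)) * Real.sqrt E) ^ 2 := by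
    rw [← sq_abs D]
    exact pow_le_pow_left₀ (abs_nonneg D) h' 2
  refine hsq.trans (le_of_eq ?_)
  rw [mul_pow, mul_pow, Real.sq_sqrt (by positivity), Real.sq_sqrt hE0, div_pow, Real.sq_sqrt hL0.le]
  have hne : Real.sqrt P.L - 1 ≠ 0 := (sub_pos.mpr hs1).ne'
  field_simp

/-! ## §5 The point-pinned Poincaré inequality -/

/-- ★ **ONE BLOCK**: if `v` vanishes at the centre `embIter k y` of the block `B^k(y)` (`d = 3`, `k ≤ m + K`), then
`Σ_{B^k(y)} v² ≤ ((1 + L³/(√L − 1)²)/4)·(L^k)³·E_k(v)(y)` — `v = (v − m) + m`, §2 for the oscillation, §4 at the centre for the mean. [folklore] -/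
theorem sum_sq_block_le_of_eq_zero_centre (hd : P.d = 3) {k : ℕ} (hk : k ≤ P.m + P.K) (v : Site P 0 → ℝ) (y : Site P k)
    (hv : v (embIter k y) = 0) :
    ∑ x ∈ univ.filter (fun x : Site P 0 => Site.proj k k x = y), v x ^ 2
      ≤ (1 + (P.L : ℝ) ^ 3 / (Real.sqrt P.L - 1) ^ 2) / 4 * ((P.L : ℝ) ^ k) ^ 3 *
          ∑ ν : Fin P.d, ∑ x ∈ univ.filter (fun x : Site P 0 => Site.proj k k x = y),
            (if Site.proj k k (x.shift ν) = y then (v (x.shift ν) - v x) ^ 2 else 0) := by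
  classical
  have h0k : P.sitesPerDir 0 = P.L ^ k * P.sitesPerDir k := sitesPerDir_zero_eq_pow_mul hk
  have hL1 : (1 : ℝ) < P.L := by exact_mod_cast P.hL.2
  have hL0 : (0 : ℝ) < P.L := by positivity
  have hs1 : 1 < Real.sqrt P.L := by
    rw [show (1 : ℝ) = Real.sqrt 1 from Real.sqrt_one.symm]
    exact Real.sqrt_lt_sqrt zero_le_one hL1
  have hsp : 0 < Real.sqrt P.L - 1 := sub_pos.mpr hs1
  set S := univ.filter (fun x : Site P 0 => Site.proj k k x = y) with hS
  set ℓ : ℝ := (P.L : ℝ) ^ k with hℓ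
  have hℓ1 : 1 ≤ ℓ := one_le_pow₀ hL1.le
  set m : ℝ := (ℓ ^ P.d)⁻¹ * ∑ x ∈ S, v x with hm
  set E : ℝ := ∑ ν : Fin P.d, ∑ x ∈ S, (if Site.proj k k (x.shift ν) = y then (v (x.shift ν) - v x) ^ 2 else 0) with hE
  have hE0 : 0 ≤ E := Finset.sum_nonneg fun _ _ => Finset.sum_nonneg fun _ _ => by split_ifs <;> positivity
  have hcard : (S.card : ℝ) = ℓ ^ P.d := card_block h0k y
  -- §2: the oscillation
  have hosc : ∑ x ∈ S, (v x - m) ^ 2 ≤ ℓ ^ 2 / 8 * E := sum_sq_sub_mean_le hk y v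
  -- §4 at the centre: the mean (`v(centre) = 0`)
  have hcen : m ^ 2 ≤ (P.L : ℝ) ^ 3 / (8 * (Real.sqrt P.L - 1) ^ 2) * E := by
    have h4 := sq_sub_mean_le_energy hd hk (embIter k y) v
    rw [proj_embIter hk y, hv, zero_sub, neg_sq] at h4
    exact h4
  -- `v² ≤ 2(v − m)² + 2m²`
  have hsplit : ∑ x ∈ S, v x ^ 2 ≤ 2 * ∑ x ∈ S, (v x - m) ^ 2 + 2 * (S.card : ℝ) * m ^ 2 := by
    rw [Finset.mul_sum, show 2 * (S.card : ℝ) * m ^ 2 = ∑ _x ∈ S, 2 * m ^ 2 by rw [Finset.sum_const, nsmul_eq_mul]; ring,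
      ← Finset.sum_add_distrib]
    exact Finset.sum_le_sum fun x _ => by nlinarith [sq_nonneg (v x - 2 * m)]
  rw [hcard, hd] at hsplit
  have hd3 : ℓ ^ 2 ≤ ℓ ^ 3 := pow_le_pow_right₀ hℓ1 (by norm_num)
  calc ∑ x ∈ S, v x ^ 2 ≤ 2 * ∑ x ∈ S, (v x - m) ^ 2 + 2 * ℓ ^ 3 * m ^ 2 := hsplit
    _ ≤ 2 * (ℓ ^ 2 / 8 * E) + 2 * ℓ ^ 3 * ((P.L : ℝ) ^ 3 / (8 * (Real.sqrt P.L - 1) ^ 2) * E) := by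
        have h1 := mul_le_mul_of_nonneg_left hcen (by positivity : (0 : ℝ) ≤ 2 * ℓ ^ 3)
        linarith [hosc, h1]
    _ ≤ 2 * (ℓ ^ 3 / 8 * E) + 2 * ℓ ^ 3 * ((P.L : ℝ) ^ 3 / (8 * (Real.sqrt P.L - 1) ^ 2) * E) := by
        have := mul_le_mul_of_nonneg_right hd3 (by positivity : (0 : ℝ) ≤ E / 8)
        linarith [this]
    _ = (1 + (P.L : ℝ) ^ 3 / (Real.sqrt P.L - 1) ^ 2) / 4 * ℓ ^ 3 * E := by
        field_simp
        ring

/-- ★★ **THE POINT-PINNED POINCARÉ INEQUALITY** (`d = 3`, `k ≤ m + K`): if `v` vanishes at every `k`-centre `embIter k y`, then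
`Σ_x v(x)² ≤ ((1 + L³/(√L − 1)²)/4)·(L^k)³·Σ_b (∂v)(b)²` — sum of §5-one-block over the blocks; interior bond pairs ≤ all bonds. [folklore] -/
theorem sum_sq_le_grad_sq_of_eq_zero_centres (hd : P.d = 3) {k : ℕ} (hk : k ≤ P.m + P.K) (v : Site P 0 → ℝ)
    (hv : ∀ y : Site P k, v (embIter k y) = 0) :
    ∑ x : Site P 0, v x ^ 2 ≤ (1 + (P.L : ℝ) ^ 3 / (Real.sqrt P.L - 1) ^ 2) / 4 * ((P.L : ℝ) ^ k) ^ 3 * ∑ b : PBond P 0, grad 1 v b ^ 2 := by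
  classical
  have hL1 : (1 : ℝ) < P.L := by exact_mod_cast P.hL.2
  have hs1 : 1 < Real.sqrt P.L := by
    rw [show (1 : ℝ) = Real.sqrt 1 from Real.sqrt_one.symm]
    exact Real.sqrt_lt_sqrt zero_le_one hL1
  have hsp : 0 < Real.sqrt P.L - 1 := sub_pos.mpr hs1
  set C : ℝ := (1 + (P.L : ℝ) ^ 3 / (Real.sqrt P.L - 1) ^ 2) / 4 * ((P.L : ℝ) ^ k) ^ 3 with hC
  have hC0 : 0 ≤ C := by positivity
  -- fibrewise over the blocks
  have hfib : ∑ x : Site P 0, v x ^ 2 = ∑ y : Site P k, ∑ x ∈ univ.filter (fun x : Site P 0 => Site.proj k k x = y), v x ^ 2 :=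
    (Finset.sum_fiberwise (Finset.univ : Finset (Site P 0)) (Site.proj k k) (fun x : Site P 0 => v x ^ 2)).symm
  have hblocks : ∑ y : Site P k, ∑ x ∈ univ.filter (fun x : Site P 0 => Site.proj k k x = y), v x ^ 2
      ≤ ∑ y : Site P k, C * ∑ ν : Fin P.d, ∑ x ∈ univ.filter (fun x : Site P 0 => Site.proj k k x = y),
          (if Site.proj k k (x.shift ν) = y then (v (x.shift ν) - v x) ^ 2 else 0) :=
    Finset.sum_le_sum fun y _ => by simpa only [hC] using sum_sq_block_le_of_eq_zero_centre hd hk v y (hv y)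
  -- interior bond pairs ≤ all bonds
  have hall : ∑ y : Site P k, ∑ ν : Fin P.d, ∑ x ∈ univ.filter (fun x : Site P 0 => Site.proj k k x = y),
        (if Site.proj k k (x.shift ν) = y then (v (x.shift ν) - v x) ^ 2 else 0)
      ≤ ∑ b : PBond P 0, grad 1 v b ^ 2 := by
    have e1 : ∀ y : Site P k, (∑ ν : Fin P.d, ∑ x ∈ univ.filter (fun x : Site P 0 => Site.proj k k x = y),
          (if Site.proj k k (x.shift ν) = y then (v (x.shift ν) - v x) ^ 2 else 0))
        = ∑ x ∈ univ.filter (fun x : Site P 0 => Site.proj k k x = y), ∑ ν : Fin P.d,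
          (if Site.proj k k (x.shift ν) = y then (v (x.shift ν) - v x) ^ 2 else 0) := fun y => Finset.sum_comm
    have e2 : ∀ y : Site P k, (∑ x ∈ univ.filter (fun x : Site P 0 => Site.proj k k x = y), ∑ ν : Fin P.d,
          (if Site.proj k k (x.shift ν) = y then (v (x.shift ν) - v x) ^ 2 else 0))
        = ∑ x ∈ univ.filter (fun x : Site P 0 => Site.proj k k x = y), ∑ ν : Fin P.d,
          (if Site.proj k k (x.shift ν) = Site.proj k k x then (v (x.shift ν) - v x) ^ 2 else 0) := fun y =>
      Finset.sum_congr rfl fun x hx => by rw [(Finset.mem_filter.mp hx).2]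
    simp only [e1, e2]
    rw [Finset.sum_fiberwise (Finset.univ : Finset (Site P 0)) (Site.proj k k)
      (fun x : Site P 0 => ∑ ν : Fin P.d, (if Site.proj k k (x.shift ν) = Site.proj k k x then (v (x.shift ν) - v x) ^ 2 else 0)),
      sum_pbond]
    refine Finset.sum_le_sum fun x _ => Finset.sum_le_sum fun ν _ => ?_
    have hg : grad 1 v ⟨x, ν⟩ ^ 2 = (v (x.shift ν) - v x) ^ 2 := by simp only [grad, one_smul, PBond.tgt]
    rw [hg]
    split_ifs
    · exact le_rfl
    · exact sq_nonneg _
  rw [hfib]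
  refine hblocks.trans ?_
  rw [← Finset.mul_sum]
  exact mul_le_mul_of_nonneg_left hall hC0

/-- The frozen name of the cell's W-SEAT MAP (OWNER g26, ASSIGNMENTS 8 (a)) for `sum_sq_le_grad_sq_of_eq_zero_centres`, verbatim. [folklore] -/
theorem sum_sq_le_of_eq_zero_embIter (hd : P.d = 3) {k : ℕ} (hk : k ≤ P.m + P.K) (v : Site P 0 → ℝ)
    (hv : ∀ y : Site P k, v (embIter k y) = 0) :
    ∑ x : Site P 0, v x ^ 2 ≤ (1 + (P.L : ℝ) ^ 3 / (Real.sqrt P.L - 1) ^ 2) / 4 * ((P.L : ℝ) ^ k) ^ 3 * ∑ b : PBond P 0, grad 1 v b ^ 2 :=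
  sum_sq_le_grad_sq_of_eq_zero_centres hd hk v hv

end Summit.QuantumFields.YangMills.Theorems.Prop7PointPinnedPoincare

end
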